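import Summits.BirchSwinnertonDyer.BirchSwinnertonDyer.Theorems.SignedLowerHalvesSmallImageLowerHalfBothSignsRttJunctionShaIotaSelmer
import Summits.BirchSwinnertonDyer.BirchSwinnertonDyer.Theorems.ThetaPartnerAtTwoSignedMainConjectureCMTwoRankZeroPTDeepUnramifiedLocal
import Literature.NumberTheory.EllipticCurves.TwoVariableControlLocalKernelProofs
import HarnessLib

/-!
# Route `SignedLowerHalves`, crux L `SmallImageLowerHalfBothSigns` (stmt-BirchSwinnertonDyer-23599), line `rtt_w3` v35 — stub S3α″ (`stub_junctionShaPi_ns`),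
# brick α5′-3d: THE COMPARISON MAPS ARE STRICT OFF `p` OVER THE CYCLOTOMIC TOWER — `loc_w (ι_{n,k} z) = 0` at EVERY `w ∤ p` («unramified ⟹ locally trivial over `K_∞`»),
# hence `ι_{n,k} : Ш¹_P(K_n, A[p^k]) → Sel_{str at Σ}(K_∞, A)` for ANY `Σ` with `Σ ∩ {w ∣ p} ⊆ P`

INPUTS hand `bsd-inputs-honda-p1` g29 under LEAD `cruxlead-stmt-BirchSwinnertonDyer-23599` (cell `bsd-ssimc`); helper `--supports stmt-BirchSwinnertonDyer-23599`.
DEFINITIONS WITH BODIES (`toKerInfDecomp`, `iotaSelOf`) + THEOREMS; no named fact, no instance, no `sorry`. The stub's strict set is `Σ = S₀K ∪ {w ∣ p}` and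
`S₀K ⊄ P = supp(p𝔣)` in general, so the sibling file's `iotaSel` (which needs `Σ ⊆ P`) is not enough; here, for the CYCLOTOMIC `κ` (`hκ`) and a `p`-primary
`A` (`htor`): at `w ∤ p` the layer class `ι^{layer} z` is unramified (`iotaLayerO_mem_unramifiedOutside`), so `ι z ∈ H¹(K_∞, A)` dies on `Gal(K̄/K_∞) ⊓ D_w` by the
tree's `SignedLowerOffTwo.PTDeep.resOfLe_kerSubgroup_inf_decomp_eq_zero_of_unramified` (Greenberg: `Gal(K_{∞,η}^{ur}/K_{∞,η})` has pro-order prime to `p`; no finite place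
splits completely in `K^{cyc}_∞`), and lambda-p1's `locAt κ A w` factors through that restriction (`locAt_eq_comp`).
* §1 `toKerInfDecomp` (`res_ι` corestricted to `Gal(K̄/K_∞) ⊓ D_w`), `locAt_eq_comp`, ★ `locAt_iotaO_eq_zero_of_not_mem` (`w ∤ p`), `locAt_iotaO_eq_zero'`
  (`w ∈ P` or `w ∤ p`);
* §2 ★ `iotaSelOf n k : Ш¹_P(K_n, A[p^k]) →+ strictSelmer κ A R V j S₀ ε Σ` under `hΣ : ∀ w ∈ Σ, p ∈ w → w ∈ P`, with the laws `iotaSelOf_resYO/_inclYO/_conjYO` and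
  `iotaSelOf_eq_zero_iff`.
HONEST FRAMING: cohomological bookkeeping; α5′, S3α″, crux L and BSD are NOT proved here and remain OPEN; BSD is proved for NO curve.
References: [GreenbergLNM1716] §2 (p. 70); [NeukirchANT1999] Ch. II §9 Prop. (9.6); [Kobayashi2003] Thm. 7.3 i); [SerreGaloisCohomology1997] I §2.4–2.5, II §1.1;
[JohnsonLeungKings2011] §5.4 Lemma 5.8.
-/

set_option autoImplicit false
set_option linter.dupNamespace false -- D-0017: single-problem summit, the namespace repeats the problem name by design
noncomputable section

open scoped Classical
open NumberField IsDedekindDomain Field Function CategoryTheory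

namespace Summit.BirchSwinnertonDyer.BirchSwinnertonDyer.Theorems.SmallImageRttJunctionSha

open Literature.NumberTheory.EllipticCurves Literature.NumberTheory.EllipticCurves.GreenbergVatsal2000 Literature.NumberTheory.EllipticCurves.GreenbergSelmer
  Literature.NumberTheory.GaloisRepresentations Literature.NumberTheory.GaloisRepresentations.DiscreteGaloisModule Literature.NumberTheory.GaloisCohomology
  Literature.NumberTheory.GaloisCohomology.ShaLayer Summit.BirchSwinnertonDyer.BirchSwinnertonDyer.Theorems.SmallImageRttD2Seq
  Summit.BirchSwinnertonDyer.BirchSwinnertonDyer.Theorems.SmallImageCharSignedSelmer Summit.BirchSwinnertonDyer.BirchSwinnertonDyer.Theorems.SignedLowerOffTwo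

/-! ## §1 `loc_w (ι z) = 0` at `w ∤ p` over the cyclotomic tower -/

section Deep

variable {K : Type} [Field K] [NumberField K] {p : ℕ} [Fact p.Prime] (κ : ZpExtension K p) (P : Set (HeightOneSpectrum (𝓞 K)))
  (M : Type) [AddCommGroup M] [DistribMulAction (absoluteGaloisGroup K) M] [TopologicalSpace M] [DiscreteTopology M]
  (hstab : ∀ m : M, IsOpen (MulAction.stabilizer (absoluteGaloisGroup K) m : Set (absoluteGaloisGroup K)))

/-- **`res_ι : Gal(K̄_w/K_∞·K_w) → Gal(K̄/K_∞) ⊓ D_w`** (the tree's `resGalSubgroupOfEmb` corestricted to its image; `D_w = decomp w` is the image of `Γ_{K_w}`).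
[cite: NeukirchANT1999, Ch. II §9 Prop. (9.6)] [cite: SerreGaloisCohomology1997, II §1.1] -/
def toKerInfDecomp (w : HeightOneSpectrum (𝓞 K)) :
    ↥(localSubgroupOfEmb κ.kerSubgroup (closureEmb (K := K) (w.adicCompletion K))) →ₜ* ↥(κ.kerSubgroup ⊓ decomp (K := K) w) where
  toFun τ := ⟨resGalOfEmb (closureEmb (K := K) (w.adicCompletion K)) τ, Subgroup.mem_inf.2 ⟨τ.2, ⟨(τ : absoluteGaloisGroup (w.adicCompletion K)), rfl⟩⟩⟩
  map_one' := Subtype.ext (map_one _)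
  map_mul' _ _ := Subtype.ext (map_mul _ _ _)
  continuous_toFun := ((map_continuous (resGalOfEmb (closureEmb (K := K) (w.adicCompletion K)))).comp continuous_subtype_val).subtype_mk _

/-- **`loc_w` factors through the restriction to `Gal(K̄/K_∞) ⊓ D_w`** (both composites are restriction along `res_ι`). [cite: SerreGaloisCohomology1997, I §2.5] -/
theorem locAt_eq_comp (w : HeightOneSpectrum (𝓞 K)) :
    letI := localAction (closureEmb (K := K) (w.adicCompletion K)) M
    locAt κ M w = (resH1Hom (toKerInfDecomp κ w) (AddMonoidHom.id M) fun _ _ ↦ rfl).comp (resOfLe M (inf_le_left : κ.kerSubgroup ⊓ decomp (K := K) w ≤ κ.kerSubgroup)) := by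
  letI := localAction (closureEmb (K := K) (w.adicCompletion K)) M
  change locH1 κ M w (fun _ _ ↦ rfl) = _
  rw [locH1, resOfLe, resH1Hom_comp]
  exact resH1Hom_congr (by ext; rfl) (by ext; rfl) _ _

variable (hκ : κ.IsCyclotomic) (htor : ∀ m : M, ∃ k : ℕ, p ^ k • m = 0)

include hκ htor in
/-- ★ **`loc_w (ι_{n,k} z) = 0` at every `w ∤ p`** over the CYCLOTOMIC tower: the layer class `ι^{layer} z ∈ H¹(U_n, A)` is unramified at `w` (`iotaLayerO_mem_unramifiedOutside`),
so `ι z` restricted to `Gal(K̄/K_∞) ⊓ r(I_𝔐)` vanishes, hence (Greenberg: `H¹(Gal(K_{∞,η}^{ur}/K_{∞,η}), ·) = 0` on `p`-primary modules, no finite `w ∤ p` splits completely in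
`K^{cyc}_∞`; the tree's `PTDeep.resOfLe_kerSubgroup_inf_decomp_eq_zero_of_unramified`) on `Gal(K̄/K_∞) ⊓ D_w`, through which `loc_w` factors. [cite: GreenbergLNM1716, §2 (p. 70)]
[cite: NeukirchANT1999, Ch. II §9 Prop. (9.6)] -/
theorem locAt_iotaO_eq_zero_of_not_mem {w : HeightOneSpectrum (𝓞 K)} (hpw : ((p : ℕ) : 𝓞 K) ∉ w.asIdeal) (n k : ℕ)
    (z : ↥(layerShaRestricted P (torsRep M hstab p k) (κ.layerSubgroup n) 1)) :
    locAt κ M w (iotaO κ P M hstab n k z) = 0 := by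
  haveI : ContinuousSMul (absoluteGaloisGroup K) M := continuousSMul_iff_stabilizer_isOpen.mpr hstab
  -- (`have …; obtain … := this`: `obtain` on a compound term generalises it over the goal — an isDefEq explosion on these carriers)
  have h𝔐' := w.localPrimesAbove_nonempty
  obtain ⟨𝔐, h𝔐⟩ := h𝔐'
  have hF' := w.exists_isArithFrobAt_localAbsIntegers h𝔐
  obtain ⟨F, hF⟩ := hF'
  have hFD := PTDeep.not_mem_localSubgroup_kerSubgroup_of_isCyclotomic w κ hκ hpw h𝔐 hF
  -- the layer class is unramified at `w`: its restriction to `U_n ⊓ I_w` vanishes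
  have hunr₀ : resOfLe M (inf_le_left : κ.layerSubgroup n ⊓ inertia w ≤ κ.layerSubgroup n) (iotaLayerO κ P M hstab n k z) = 0 := by
    have h := (mem_unramifiedOutside_iff _).1 (iotaLayerO_mem_unramifiedOutside κ P M hstab ∅ n k z) w (Set.notMem_empty w) hpw 1
    rw [conjH1_one_holds (κ.layerSubgroup n) M, AddMonoidHom.id_apply] at h
    exact (mem_unramifiedKer_iff_resOfLe_eq_zero _ w _).1 h
  -- transport to `Gal(K̄/K_∞) ⊓ r(I_𝔐)`, `r(I_𝔐) = I_w`
  have hIw : (𝔐.inertia (absoluteGaloisGroup (w.adicCompletion K))).map (resGal (K := K) (w.adicCompletion K)).toMonoidHom = inertia (K := K) w :=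
    PTDeep.map_inertia_eq_inertia w h𝔐
  have hle : κ.kerSubgroup ⊓ (𝔐.inertia (absoluteGaloisGroup (w.adicCompletion K))).map (resGal (K := K) (w.adicCompletion K)).toMonoidHom ≤
      κ.layerSubgroup n ⊓ inertia (K := K) w := inf_le_inf (κ.kerSubgroup_le_layerSubgroup n) hIw.le
  have hunr : resOfLe M (inf_le_left : κ.kerSubgroup ⊓
      (𝔐.inertia (absoluteGaloisGroup (w.adicCompletion K))).map (resGal (K := K) (w.adicCompletion K)).toMonoidHom ≤ κ.kerSubgroup) (iotaO κ P M hstab n k z) = 0 := by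
    rw [← resOfLe_iotaLayerO, ← AddMonoidHom.comp_apply, resOfLe_comp_holds, ← resOfLe_comp_holds (M := M) hle inf_le_left, AddMonoidHom.comp_apply, hunr₀, map_zero]
  have key := PTDeep.resOfLe_kerSubgroup_inf_decomp_eq_zero_of_unramified w κ hpw h𝔐 hF hFD M htor (iotaO κ P M hstab n k z) hunr
  rw [locAt_eq_comp, AddMonoidHom.comp_apply, key, map_zero]

variable (hpP : ∀ v : HeightOneSpectrum (𝓞 K), ((p : ℕ) : 𝓞 K) ∈ v.asIdeal → v ∈ P)

include hκ htor hpP in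
/-- **`loc_w (ι_{n,k} z) = 0` at every place `w` with `w ∈ P` or `w ∤ p`** — i.e. at EVERY `w` when `P ⊇ {w ∣ p}`. [cite: Kobayashi2003, Thm. 7.3 i)] [cite: GreenbergLNM1716, §2 (p. 70)] -/
theorem locAt_iotaO_eq_zero' (w : HeightOneSpectrum (𝓞 K)) (n k : ℕ) (z : ↥(layerShaRestricted P (torsRep M hstab p k) (κ.layerSubgroup n) 1)) :
    locAt κ M w (iotaO κ P M hstab n k z) = 0 := by
  by_cases hpw : ((p : ℕ) : 𝓞 K) ∈ w.asIdeal
  · exact locAt_iotaO_eq_zero κ P M hstab (hpP w hpw) n k z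
  · exact locAt_iotaO_eq_zero_of_not_mem κ P M hstab hκ htor hpw n k z

end Deep

/-! ## §2 The comparison maps into `Sel_{str at Σ}(K_∞, A)` for an arbitrary `Σ` -/

section Sel

variable {K : Type} [Field K] [NumberField K] {p : ℕ} [Fact p.Prime] (κ : ZpExtension K p) (P : Set (HeightOneSpectrum (𝓞 K)))
  (M : Type) [AddCommGroup M] [DistribMulAction (absoluteGaloisGroup K) M] [TopologicalSpace M] [DiscreteTopology M]
  (hstab : ∀ m : M, IsOpen (MulAction.stabilizer (absoluteGaloisGroup K) m : Set (absoluteGaloisGroup K)))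
  (R : Type*) [Ring R] [Module R M] (V : WeierstrassCurve K) (j : V.geomPrimaryTorsion p →+ M) (S₀ : Set (HeightOneSpectrum (𝓞 K))) (ε : ℤˣ)
  (S₁ : Set (HeightOneSpectrum (𝓞 K))) (hκ : κ.IsCyclotomic) (htor : ∀ m : M, ∃ k : ℕ, p ^ k • m = 0)
  (hpP : ∀ v : HeightOneSpectrum (𝓞 K), ((p : ℕ) : 𝓞 K) ∈ v.asIdeal → v ∈ P)

/-- ★ **`ι_{n,k} : Ш¹_P(K_n, A[p^k]) →+ Sel_{str at Σ}(K_∞, A)` for ANY `Σ`** over the cyclotomic tower (`P ⊇ {w ∣ p}`, `A` `p`-primary): every conjugate of `ι z` is killed by every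
`loc_w` (`locAt_iotaO_eq_zero'`). The comparison maps of the Poitou–Tate socket for the stub's `U := strictSelmer … (S₀K ∪ {w ∣ p})`. [cite: Kobayashi2003, Thm. 7.3 i)]
[cite: JohnsonLeungKings2011, §5.4 Lemma 5.8] -/
def iotaSelOf (n k : ℕ) : ↥(layerShaRestricted P (torsRep M hstab p k) (κ.layerSubgroup n) 1) →+ ↥(strictSelmer κ M R V j S₀ ε S₁) :=
  (iotaSat κ P M hstab R V j S₀ ε hpP n k).codRestrict _ fun z ↦ (mem_strictSelmer_iff κ M R V j S₀ ε S₁ _).2 fun w _ σ ↦ by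
    rw [coe_iotaSat, ← iotaO_conjYO]
    exact locAt_iotaO_eq_zero' κ P M hstab hκ htor hpP w n k _

/-- Values of `iotaSelOf`. [folklore] -/
theorem coe_coe_iotaSelOf (n k : ℕ) (z : ↥(layerShaRestricted P (torsRep M hstab p k) (κ.layerSubgroup n) 1)) :
    (((iotaSelOf κ P M hstab R V j S₀ ε S₁ hκ htor hpP n k z : ↥(strictSelmer κ M R V j S₀ ε S₁)) : ↥(signedTransportSelmerInftySat κ M R V j S₀ ε)) :
        subgroupH1 κ.kerSubgroup M) = iotaO κ P M hstab n k z := rfl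

/-- `ι^{Sel} z = 0 ↔ ι z = 0`. [folklore] -/
theorem iotaSelOf_eq_zero_iff (n k : ℕ) (z : ↥(layerShaRestricted P (torsRep M hstab p k) (κ.layerSubgroup n) 1)) :
    iotaSelOf κ P M hstab R V j S₀ ε S₁ hκ htor hpP n k z = 0 ↔ iotaO κ P M hstab n k z = 0 := by
  rw [← coe_coe_iotaSelOf κ P M hstab R V j S₀ ε S₁ hκ htor hpP n k z]
  exact ⟨fun h ↦ by rw [h]; rfl, fun h ↦ Subtype.ext (Subtype.ext h)⟩

variable (hNP : ∀ n : ℕ, ramificationSubgroup K P ≤ κ.layerSubgroup n) (hA : ∀ k : ℕ, ramificationSubgroup K P ≤ ContinuousRep.ker (torsRep M hstab p k))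

/-- **Law (res)** for `iotaSelOf`. [cite: SerreGaloisCohomology1997, I §2.5] -/
theorem iotaSelOf_resYO (n k : ℕ) (z : ↥(layerShaRestricted P (torsRep M hstab p k) (κ.layerSubgroup n) 1)) :
    iotaSelOf κ P M hstab R V j S₀ ε S₁ hκ htor hpP (n + 1) k (resYO κ P M hstab hNP hA n k z) = iotaSelOf κ P M hstab R V j S₀ ε S₁ hκ htor hpP n k z :=
  Subtype.ext (Subtype.ext (iotaO_resYO κ P M hstab hNP hA n k z))

/-- **Law (incl)** for `iotaSelOf`. [cite: SerreGaloisCohomology1997, I §2.4] -/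
theorem iotaSelOf_inclYO (n k : ℕ) (z : ↥(layerShaRestricted P (torsRep M hstab p k) (κ.layerSubgroup n) 1)) :
    iotaSelOf κ P M hstab R V j S₀ ε S₁ hκ htor hpP n (k + 1) (inclYO κ P M hstab hNP hA n k z) = iotaSelOf κ P M hstab R V j S₀ ε S₁ hκ htor hpP n k z :=
  Subtype.ext (Subtype.ext (iotaO_inclYO κ P M hstab hNP hA n k z))

/-- **Law (conj)** for `iotaSelOf`: `ι (conj_δ z) = conjStrict δ (ι z)`. [cite: SerreLocalFields1979, VII §5 Prop. 3] [cite: GreenbergVatsal2000, §2 p. 17] -/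
theorem iotaSelOf_conjYO (n k : ℕ) (δ : absoluteGaloisGroup K) (z : ↥(layerShaRestricted P (torsRep M hstab p k) (κ.layerSubgroup n) 1)) :
    iotaSelOf κ P M hstab R V j S₀ ε S₁ hκ htor hpP n k (conjYO κ P M hstab n k δ z) =
      conjStrict κ M R V j S₀ ε S₁ δ (iotaSelOf κ P M hstab R V j S₀ ε S₁ hκ htor hpP n k z) := by
  apply Subtype.ext; apply Subtype.ext
  change iotaO κ P M hstab n k (conjYO κ P M hstab n k δ z) = conjH1 κ.kerSubgroup M δ (iotaO κ P M hstab n k z)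
  exact iotaO_conjYO κ P M hstab n k δ z

end Sel

end Summit.BirchSwinnertonDyer.BirchSwinnertonDyer.Theorems.SmallImageRttJunctionSha

end
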